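import Literature.MathematicalPhysics.QuantumFieldTheory.Balaban1983to89.B9Eq335PlaquetteAtLettersY
import Literature.MathematicalPhysics.QuantumFieldTheory.Balaban1983to89.B9Thm311DeltaAFrustratedWitness

/-!
# `Balaban1983to89.B9Eq335CoverageAtLettersY` — T. Bałaban, *Propagators for lattice gauge theories in a background field*, Commun. Math. Phys. **99** (1985)
# 389–434 [Balaban1985BackgroundPropagators] p. 396 (the cube class of (3.35)) read on def-Y's typed class `B9BackgroundsKLevelV1.cubeClass396 ∕ bg9K.Reg335`:
# WHICH BONDS AND PLAQUETTES THE TYPED CLASS (3.35) CONSTRAINS — block coverage (positive, as typed), the blindness of the class to a bond that no class cube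
# contains with both endpoints (a central flip there stays in the class), and the (3.69) plaquette estimate for block-interior plaquettes with NO coverage binder
# (file 4 of this seat's (3.69) set; files 1–3 = `B9Ineq369CurvatureSmallAtLettersY`, `B9Thm311PosOfPrincipalAtLettersY`, `B9Eq335PlaquetteAtLettersY`)

statement-level skeleton of published theorems with citation tags; proofs where landed; nothing here is a claim about the Yang–Mills mass gap

PDF held: `paper:balaban1985-cmp99-background-propagators` (journal page = PDF page + 388); p. 396 read by this seat (2026-08-27).

THE PRINT (verbatim, p. 396).  *«At first let us introduce a class of cubes. For each cube □ of this class there exists a unique index j, 0 ≤ j ≤ k, such that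
□ ⊂ Bʲ(Λ_j) ∪ B^{j+1}(Λ_{j+1}), □ ∩ Bʲ(Λ_j) ≠ ∅, and □ is a union of several big blocks of the lattice T_{Lʲη}, which implies that its size in the lattice T_η is
O(1)MLʲη. Here O(1) will mean a number ≤ 10. … for an arbitrary cube □ of the described above class, and for a configuration U there exists a gauge transformation u
on □ such that U^u = e^{iηA} …»*

WHY THIS FILE (cell context).  File 3 delivered the two (3.69) plaquette estimates PER CLASS CUBE: for a plaquette whose sites `x, x+e_μ, x+e_ν` lie in one cube of
def-Y's `cubeClass396 i`.  The N06 certificate's binders (`h39`, `h36*`, `hΔA`, …) are premised on `(bg9Y …).Reg335 c35Y α₀ U`, i.e. on the typed class, so what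
that class constrains is exactly what those premises carry.  This file records the three facts the consumers and the geometry lane (def-Y, n06-i) need, all
BOOKKEEPING on def-Y's definitions: (1) POSITIVE, as typed — the big `(lev x)`-block of any site is a class cube containing the WHOLE block (def-Y's
`exists_mem_cubeClass396` with the conclusion extended from the site to its block), so every block-interior plaquette is covered and gets the (3.69) estimate with NO
coverage binder (`norm_holY_sub_one_le_of_reg335_interior`); (2) the typed `Reg335Cube` on a coordinate cube □ asks the cube-gauge identity only for bonds with SOURCE
in □ and bounds the gauge `u` only ON □, so if □ does not contain both endpoints of a bond `b₀` the datum for `U` yields the datum for `U` flipped at `b₀` by any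
central unit `g` (re-choose `u` at the outside endpoint; face geometry: no other bond from □ ends there) — hence (3) if NO class cube contains both endpoints of `b₀`
(«uncovered bond») the member class `(bg9K 𝔸 G i).Reg335 c α₀` is invariant under `U(b₀) ↦ gU(b₀)`, `g ∈ G` central (at the record: `g = −1 ∈ SU(N)`, `N` even), and
then the plaquettes `p_{μ₀ν}(x₀)` through `b₀` have `U′(∂p) = gU(∂p)` — the typed premise does not make them small.  WHETHER an uncovered bond exists is a property
of the member's domain sequence `TDomains` (its axioms (2.1) `bigBlocks`, (2.2) `sepT` admit a one-block-thick level-`j` slab whose big-block-face bonds are uncovered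
when `L ≥ 19`; this seat's bus line LOCATED-COVERAGE-1, dag-lead g10 DESK WORD: holder of the coverage lemma = this seat, class amendment = def-Y's call, WATCH not
GAP) — NOT decided here; this file proves the two implications that make the question precise, and the positive half that holds as typed.
PRIOR ART DECLARED.  §1 is def-Y's `B9BackgroundsKLevelV1.exists_mem_cubeClass396` (p484082 lineage) with a strengthened conclusion, re-run verbatim on its public
helpers (`mem_torusCube_iff_blk`, `blk_toBox_eq_iff`, `blk_toBox_eq_mul`, `bigSide_eq_mul_pow`); nothing of def-Y's is modified.

WHAT IS PROVED (sorry-free; 0 `def`; nothing of [B9] asserted).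
* §1 ★★ `exists_cubeClass396_block` (`∃ (□, lev x) ∈ cubeClass396 i` containing every `y` with the same big-`(lev x)`-block label as `x`).
* §2 (any complete normed ℂ-algebra `𝔸`; the flip `U′ := Function.update U μ₀ (Function.update (U μ₀) x₀ (g * U μ₀ x₀))`): `update_apply_of_ne ∕ _self`, ★
  `eq_of_shift_eq_of_mem_torusCube` (face geometry of a coordinate cube: `x₀ ∈ □ ∌ x₀+e_{μ₀}`, `z ∈ □`, `z+e_κ = x₀+e_{μ₀}` ⇒ `κ = μ₀ ∧ z = x₀`), ★★
  `reg335Cube_update` (`Reg335Cube` on `torusCube c s` not containing both endpoints ⇒ the same for `U′`, `g` central — no size condition on `g` is needed), ★★★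
  **`reg335_update_of_uncovered`** (no class cube contains both endpoints of `b₀`, `g ∈ G` central ⇒ `(bg9K 𝔸 G i).Reg335 c α₀ U → (bg9K 𝔸 G i).Reg335 c α₀ U′`).
* §3 `shift_ne_self` (the torus has ≥ 2 sites per direction), ★ `holY_update_eq` (`U′(∂p) = g·U(∂p)` for `p = p_{μ₀ν}(x₀)`), `neg_one_comm`, ★★★
  **`reg335_flipNegOne_of_uncovered`** (the record's case `𝔸 = M_N(ℂ)`, `G = SU(N)`, `N` even, `g = −1`; uses this lineage's `neg_one_mem_specialUnitaryUnits`).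
* §4 ★★★ **`norm_holY_sub_one_le_of_reg335_interior`** (`(bg9K (M_N(ℂ)) G i).Reg335 c α₀ U`, the plaquette's `x+e_μ`, `x+e_ν` in the big `(lev x)`-block of `x` ⇒
  `|U(∂p) − 1| ≤ 2C(1+C)e^{4C}·L^{−2·lev x}`, `C = c·M·α₀`; file 3 BY NAME on §1's cube).
MODEL ∕ DECLARED READINGS.  (M1) def-Y's letters and classes (`CfgY`, `holY`, `bg9K`, `cubeClass396`, `torusCube`, `levV1`, block labels `blk (bigSide …) (toBox …)`).  (M2)
hypotheses DISPLAYED: in §2–§3 the uncoveredness of `b₀` (`∀ q ∈ cubeClass396 i, x₀ ∈ q.1 → x₀+e_{μ₀} ∉ q.1`) and `g` central in `G`; in §4 the block-label equalities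
of the plaquette's sites (the «block-interior» condition).  (M3) NOT HERE: existence ∕ non-existence of uncovered bonds at a member (geometry of `TDomains`); the face
plaquettes (those need an `n = 2` or index-`(j−1)` class cube); any consequence for `PosDefTr` of `Δ_a` (the local form at a flipped bond — this seat's next item).
HONEST SCOPE.  Bookkeeping on def-Y's typed class; NOT a refutation of any binder (it shows what the typed premise does and does not carry); NOT a node discharge, NOT
summit progress; count-neutral; nothing continuum ∕ OS ∕ mass gap ∕ Clay.  Cell `pub-ymgap` (HUMAN RULING D-0062), Track A node N06 [B9], seat `pub-ymgap-dag-n06-j`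
(bundle F5 rows 15–17; harness re-seat gen 11), 2026-08-27; dag-lead g10 DESK WORD on LOCATED-COVERAGE-1 (i).  NEW file importing file 3 and this lineage's
`B9Thm311DeltaAFrustratedWitness`; nothing landed is modified.  Net new unproved facts: 0.
-/

noncomputable section

namespace Literature.MathematicalPhysics.QuantumFieldTheory.Balaban1983to89.B9Eq335CoverageAtLettersY

open Literature.MathematicalPhysics.QuantumFieldTheory.Balaban1983to89
open B9Eq335PlaquetteAtLettersY Node00
open B6KLevelCensusIndexV1 B9BackgroundsKLevelV1 B6GlobalChartV1
open scoped Matrix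

/-! ## §1 COVERAGE (positive side, as typed): the big block of a site is a class cube containing the WHOLE block -/

section Block


variable {d ℓ : ℕ} {hd : 1 ≤ d + 1} {hL : Odd (ℓ + 1) ∧ 1 < ℓ + 1} {b₀ b₁ : ℝ}
variable (i : KIdx d ℓ hd hL b₀ b₁)

/-- ★★ **BLOCK COVERAGE (as typed)**: for every site `x` of level `j = levV1 i x`, there is a class cube `(□, j) ∈ cubeClass396 i` — the big `j`-block of `x` — containing
EVERY site of that block (def-Y's `exists_mem_cubeClass396` construction with its conclusion extended from `x` to the whole block; same proof).  Hence every
plaquette whose three sites `x, x+e_μ, x+e_ν` lie in one big `(lev x)`-block is covered by one class cube («block-interior plaquettes»).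
[cite: Balaban1985BackgroundPropagators, p.396 (the cube class); Balaban1984PropagatorsII, (2.1) p.224 («Ω_j … is a sum of big blocks»)] -/
theorem exists_cubeClass396_block (x : Site (PV d ℓ i.m i.K hd hL) 0) :
    ∃ q ∈ cubeClass396 i, q.2 = levV1 i x ∧ ∀ y : Site (PV d ℓ i.m i.K hd hL) 0,
      B4Reflection242.blk (B6MultiLevelBoxOperator.bigSide ℓ i.Mh (levV1 i x)) (toBox i.hN y).1 = B4Reflection242.blk (B6MultiLevelBoxOperator.bigSide ℓ i.Mh (levV1 i x)) (toBox i.hN x).1 → y ∈ q.1 := by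
  set j := levV1 i x with hjdef
  set s := B6MultiLevelBoxOperator.bigSide ℓ i.Mh j with hsdef
  have hj1 : 1 ≤ j := levV1_pos i x
  have hjk : j ≤ i.k := levV1_le i x
  have h8 : 8 ≤ i.Mh := i.hM8
  have hs : 0 < s := by rw [hsdef]; unfold B6MultiLevelBoxOperator.bigSide; positivity
  have hN : (PV d ℓ i.m i.K hd hL).sitesPerDir 0 = B6MultiLevelBoxOperator.bigSide ℓ i.Mh i.k * i.P' 0 := by
    rw [← i.hN 0, B6MultiLevelTorusOperator.N0_eq_bigSide_mul]
  have hsk : s ∣ B6MultiLevelBoxOperator.bigSide ℓ i.Mh i.k := ⟨(ℓ + 1) ^ (i.k - j), by rw [hsdef]; exact bigSide_eq_mul_pow hjk⟩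
  have hsN : s ∣ (PV d ℓ i.m i.K hd hL).sitesPerDir 0 := by rw [hN]; exact dvd_mul_of_dvd_left hsk _
  have hper : 1 * s < (PV d ℓ i.m i.K hd hL).sitesPerDir 0 := by
    rw [one_mul, hN]
    have h5 : 5 ≤ i.P' 0 := i.hP5 0
    have hsk' : s ≤ B6MultiLevelBoxOperator.bigSide ℓ i.Mh i.k := Nat.le_of_dvd (by unfold B6MultiLevelBoxOperator.bigSide; positivity) hsk
    have hbk : 0 < B6MultiLevelBoxOperator.bigSide ℓ i.Mh i.k := by unfold B6MultiLevelBoxOperator.bigSide; positivity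
    calc s ≤ B6MultiLevelBoxOperator.bigSide ℓ i.Mh i.k * 1 := by rw [mul_one]; exact hsk'
      _ < B6MultiLevelBoxOperator.bigSide ℓ i.Mh i.k * i.P' 0 := (Nat.mul_lt_mul_left hbk).2 (by omega)
  let c : Site (PV d ℓ i.m i.K hd hL) 0 := fun μ => ((s * ((x μ).val / s) : ℕ) : ZMod _)
  have hcval : ∀ μ, (c μ).val = s * ((x μ).val / s) := by
    intro μ
    show ((((s * ((x μ).val / s) : ℕ)) : ZMod ((PV d ℓ i.m i.K hd hL).sitesPerDir 0))).val = _
    rw [ZMod.val_natCast, Nat.mod_eq_of_lt]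
    exact lt_of_le_of_lt (Nat.mul_div_le _ _) (ZMod.val_lt _)
  have hc : ∀ μ, s ∣ (c μ).val := fun μ => ⟨(x μ).val / s, hcval μ⟩
  have hmem : ∀ y, y ∈ torusCube c s ↔ B4Reflection242.blk s (toBox i.hN y).1 = B4Reflection242.blk s (toBox i.hN x).1 := by
    intro y
    rw [mem_torusCube_iff_blk i hs hsN c hc, blk_toBox_eq_iff, blk_toBox_eq_iff]
    refine forall_congr' fun μ => ?_
    rw [hcval, Nat.mul_div_cancel_left _ hs]
  have hx : x ∈ torusCube c s := (hmem x).2 rfl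
  have hlev : ∀ y ∈ torusCube c s, levV1 i y = j ∨ levV1 i y = j + 1 := by
    intro y hy
    have hb := (hmem y).1 hy
    have hlo : j ≤ levV1 i y := by
      rcases Nat.lt_or_ge j 2 with hj2 | hj2
      · exact le_trans (by omega) (levV1_pos i y)
      · have := i.D.bigBlocks j hj2 (toBox i.hN x).1 (toBox i.hN x).2 (toBox i.hN y).1 (toBox i.hN y).2 hb
        exact this.1 (le_of_eq hjdef)
    have hhi : levV1 i y ≤ j + 1 := by
      rcases Nat.lt_or_ge i.k (j + 2) with hk2 | hk2
      · exact le_trans (levV1_le i y) (by omega)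
      · have hb2 : B4Reflection242.blk (B6MultiLevelBoxOperator.bigSide ℓ i.Mh (j + 2)) (toBox i.hN y).1 = B4Reflection242.blk (B6MultiLevelBoxOperator.bigSide ℓ i.Mh (j + 2)) (toBox i.hN x).1 := by
          rw [bigSide_eq_mul_pow (show j ≤ j + 2 by omega)]
          exact blk_toBox_eq_mul i hb
        have := i.D.bigBlocks (j + 2) (by omega) (toBox i.hN x).1 (toBox i.hN x).2 (toBox i.hN y).1 (toBox i.hN y).2 hb2
        have hxj : ¬ (j + 2 ≤ levV1 i x) := by rw [← hjdef]; omega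
        have hyj : ¬ (j + 2 ≤ levV1 i y) := fun h => hxj (this.2 h)
        omega
    omega
  exact ⟨(torusCube c s, j), ⟨hj1, hjk, ⟨c, 1, le_rfl, by norm_num, hc, hper, by rw [one_mul]⟩, hlev, ⟨x, hx, hjdef.symm⟩⟩, rfl,
    fun y hy => (hmem y).2 hy⟩

end Block

/-! ## §2 A central flip at one bond: `U ↦ U′`, `U′(b₀) = g·U(b₀)`, `U′ = U` elsewhere -/

section Flip

variable {d ℓ : ℕ} {hd : 1 ≤ d + 1} {hL : Odd (ℓ + 1) ∧ 1 < ℓ + 1} {b₀ b₁ : ℝ}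
variable (i : KIdx d ℓ hd hL b₀ b₁) {𝔸 : Type} [NormedRing 𝔸] [NormedAlgebra ℂ 𝔸] [CompleteSpace 𝔸]

/-- the flipped configuration agrees with `U` off the bond `⟨x₀, x₀+e_{μ₀}⟩`. [cite: Balaban1985BackgroundPropagators, (3.35) p.396, bookkeeping] -/
theorem update_apply_of_ne (U : CfgY 𝔸 i) (μ₀ : Fin (PV d ℓ i.m i.K hd hL).d) (x₀ : Site (PV d ℓ i.m i.K hd hL) 0) (g : 𝔸ˣ)
    {κ : Fin (PV d ℓ i.m i.K hd hL).d} {z : Site (PV d ℓ i.m i.K hd hL) 0} (h : ¬ (κ = μ₀ ∧ z = x₀)) :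
    Function.update U μ₀ (Function.update (U μ₀) x₀ (g * U μ₀ x₀)) κ z = U κ z := by
  by_cases hκ : κ = μ₀
  · subst hκ
    have hz : z ≠ x₀ := fun hz => h ⟨rfl, hz⟩
    rw [Function.update_self, Function.update_of_ne hz]
  · rw [Function.update_of_ne hκ]

/-- … and is `g·U(b₀)` on it. [cite: Balaban1985BackgroundPropagators, (3.35) p.396, bookkeeping] -/
theorem update_apply_self (U : CfgY 𝔸 i) (μ₀ : Fin (PV d ℓ i.m i.K hd hL).d) (x₀ : Site (PV d ℓ i.m i.K hd hL) 0) (g : 𝔸ˣ) :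
    Function.update U μ₀ (Function.update (U μ₀) x₀ (g * U μ₀ x₀)) μ₀ x₀ = g * U μ₀ x₀ := by
  rw [Function.update_self, Function.update_self]

/-- ★ **FACE GEOMETRY of a coordinate cube**: if `x₀ ∈ □ = torusCube c s` but `x₀ + e_{μ₀} ∉ □`, then NO bond with source in `□` other than `⟨x₀, x₀+e_{μ₀}⟩`
itself ends at `x₀ + e_{μ₀}` (a bond `⟨z, z+e_κ⟩`, `κ ≠ μ₀`, ending there has the same `μ₀`-coordinate as `x₀ + e_{μ₀}`, i.e. lies beyond the face).
[cite: Balaban1985BackgroundPropagators, p.396 (the cubes □ of the class), bookkeeping] -/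
theorem eq_of_shift_eq_of_mem_torusCube {c : Site (PV d ℓ i.m i.K hd hL) 0} {s : ℕ} {x₀ z : Site (PV d ℓ i.m i.K hd hL) 0}
    {μ₀ κ : Fin (PV d ℓ i.m i.K hd hL).d} (hx₀ : x₀ ∈ torusCube c s) (hx₁ : x₀.shift μ₀ ∉ torusCube c s) (hz : z ∈ torusCube c s)
    (h : z.shift κ = x₀.shift μ₀) : κ = μ₀ ∧ z = x₀ := by
  -- the coordinate in which `x₀ + e_{μ₀}` leaves the cube is `μ₀`
  have hout : ¬ ((x₀.shift μ₀) μ₀ - c μ₀).val < s := by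
    intro hlt
    apply hx₁
    intro μ
    by_cases hμ : μ = μ₀
    · subst hμ; exact hlt
    · have : (x₀.shift μ₀) μ = x₀ μ := by simp [Site.shift, Function.update_of_ne hμ]
      rw [this]; exact hx₀ μ
  have hκ : κ = μ₀ := by
    by_contra hκ
    -- `z μ₀ = (z.shift κ) μ₀ = (x₀.shift μ₀) μ₀`, contradicting `z ∈ □`
    have h1 : (z.shift κ) μ₀ = z μ₀ := by simp [Site.shift, Function.update_of_ne (Ne.symm hκ)]
    have h2 : z μ₀ = (x₀.shift μ₀) μ₀ := by rw [← h1, h]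
    exact hout (h2 ▸ hz μ₀)
  subst hκ
  refine ⟨rfl, ?_⟩
  funext ν
  have hν := congrFun h ν
  by_cases hνκ : ν = κ
  · subst hνκ
    simpa [Site.shift] using hν
  · simpa [Site.shift, Function.update_of_ne hνκ] using hν

/-- ★★ **(3.35) ON A COORDINATE CUBE DOES NOT SEE A BOND LEAVING THROUGH A FACE (or outside)**: if `□ = torusCube c s` does not contain BOTH endpoints of
`b₀ = ⟨x₀, x₀+e_{μ₀}⟩`, then the cube datum of (3.35) for `U` yields the cube datum for the configuration flipped at `b₀` by a central unit `g`
(`U′(b₀) = gU(b₀)`; no size condition on `g` is needed — (3.35) bounds the gauge `u` only ON the cube): the gauge `u` is re-chosen at the single site `x₀ + e_{μ₀} ∉ □` (where (3.35) puts no condition on `u`), the potential `A` is unchanged.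
[cite: Balaban1985BackgroundPropagators, (3.35) p.396] -/
theorem reg335Cube_update {U : CfgY 𝔸 i} {c : Site (PV d ℓ i.m i.K hd hL) 0} {s : ℕ} {η ξ C : ℝ}
    {μ₀ : Fin (PV d ℓ i.m i.K hd hL).d} {x₀ : Site (PV d ℓ i.m i.K hd hL) 0} {g : 𝔸ˣ}
    (hgc : ∀ v : 𝔸ˣ, g * v = v * g)
    (hnot : x₀ ∈ torusCube c s → x₀.shift μ₀ ∉ torusCube c s)
    (h : B9Eq335RegularityClasses.Reg335Cube (shiftsV1 _) U η (torusCube c s) ξ C) :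
    B9Eq335RegularityClasses.Reg335Cube (shiftsV1 _) (Function.update U μ₀ (Function.update (U μ₀) x₀ (g * U μ₀ x₀))) η (torusCube c s) ξ C := by
  obtain ⟨u, A, hu, hgauge, hA, hD⟩ := h
  by_cases hx₀ : x₀ ∈ torusCube c s
  · have hx₁ := hnot hx₀
    -- re-choose the gauge at the outside endpoint: `u′(x₀+e_{μ₀}) = g·u(x₀+e_{μ₀})`
    refine ⟨Function.update u (x₀.shift μ₀) (g * u (x₀.shift μ₀)), A, ?_, ?_, hA, hD⟩
    · intro z hz
      have hz' : z ≠ x₀.shift μ₀ := fun e => hx₁ (e ▸ hz)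
      rw [Function.update_of_ne hz']
      exact hu z hz
    · intro κ z hz
      have hz' : z ≠ x₀.shift μ₀ := fun e => hx₁ (e ▸ hz)
      have hgz := hgauge κ z hz
      unfold B9Eq3117Current.gaugeTr at hgz ⊢
      rw [shiftsV1_apply] at hgz ⊢
      rw [Function.update_of_ne hz']
      by_cases hb : κ = μ₀ ∧ z = x₀
      · obtain ⟨rfl, rfl⟩ := hb
        -- `u z * (g * U) * (u(z+e)⁻¹ * g⁻¹) = u z * U * u(z+e)⁻¹` by centrality of `g`
        rw [update_apply_self, Function.update_self, ← hgz, mul_inv_rev, hgc (U κ z)]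
        simp only [mul_assoc]
        rw [hgc ((u (z.shift κ))⁻¹ * g⁻¹), inv_mul_cancel_right]
      · rw [update_apply_of_ne i U μ₀ x₀ g hb]
        have hne : z.shift κ ≠ x₀.shift μ₀ := fun e => hb (eq_of_shift_eq_of_mem_torusCube i hx₀ hx₁ hz e)
        rw [Function.update_of_ne hne, hgz]
  · -- `x₀ ∉ □`: the bond `b₀` is never a bond with source in `□`
    refine ⟨u, A, hu, fun κ z hz => ?_, hA, hD⟩
    have hb : ¬ (κ = μ₀ ∧ z = x₀) := fun hb => hx₀ (hb.2 ▸ hz)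
    have hgz := hgauge κ z hz
    unfold B9Eq3117Current.gaugeTr at hgz ⊢
    rw [update_apply_of_ne i U μ₀ x₀ g hb]
    exact hgz

/-- ★★★ **THE TYPED CLASS (3.35) OF A MEMBER DOES NOT CONSTRAIN AN UNCOVERED BOND**: if NO class cube of `cubeClass396 i` contains both endpoints of
`b₀ = ⟨x₀, x₀+e_{μ₀}⟩`, then membership of `U` in def-Y's `(bg9K 𝔸 G i).Reg335 c α₀` is preserved by the flip `U(b₀) ↦ g·U(b₀)` for every central
`g ∈ G` (e.g. `g = −1 ∈ SU(N)`, `N` even; no size condition on `g`) — so at such a bond the typed premise of the N06 binders `Reg335 c35Y α₀ U → …` admits the plaquette variables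
`U′(∂p) = g·U(∂p)` on all plaquettes through `b₀`. (Whether an uncovered bond EXISTS is a question about the member's `TDomains`; see the module docstring.)
[cite: Balaban1985BackgroundPropagators, (3.35) p.396] -/
theorem reg335_update_of_uncovered {G : Subgroup 𝔸ˣ} {U : CfgY 𝔸 i} {c α₀ : ℝ} {μ₀ : Fin (PV d ℓ i.m i.K hd hL).d}
    {x₀ : Site (PV d ℓ i.m i.K hd hL) 0} {g : 𝔸ˣ} (hgG : g ∈ G) (hgc : ∀ v : 𝔸ˣ, g * v = v * g)
    (hunc : ∀ q ∈ cubeClass396 i, x₀ ∈ q.1 → x₀.shift μ₀ ∉ q.1)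
    (h : (bg9K 𝔸 G i).Reg335 c α₀ U) :
    (bg9K 𝔸 G i).Reg335 c α₀ (Function.update U μ₀ (Function.update (U μ₀) x₀ (g * U μ₀ x₀))) := by
  refine ⟨fun κ z => ?_, fun q hq => ?_⟩
  · by_cases hb : κ = μ₀ ∧ z = x₀
    · obtain ⟨rfl, rfl⟩ := hb
      rw [update_apply_self]
      exact G.mul_mem hgG (h.1 κ z)
    · rw [update_apply_of_ne i U μ₀ x₀ g hb]
      exact h.1 κ z
  · obtain ⟨c', n, -, -, -, -, hcube⟩ := hq.2.2.1
    have hq' := h.2 q hq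
    rw [hcube] at hq' ⊢
    exact reg335Cube_update i hgc (fun hx => hcube ▸ hunc q hq (hcube ▸ hx)) hq'

end Flip

/-! ## §3 What the flip does to the plaquettes through `b₀`, and the record's case `G = SU(N)`, `g = −1` -/

section Consequences

variable {d ℓ : ℕ} {hd : 1 ≤ d + 1} {hL : Odd (ℓ + 1) ∧ 1 < ℓ + 1} {b₀ b₁ : ℝ}
variable (i : KIdx d ℓ hd hL b₀ b₁) {𝔸 : Type} [NormedRing 𝔸] [NormedAlgebra ℂ 𝔸] [CompleteSpace 𝔸]

/-- the fine torus has at least two sites per direction (`2·L^{m+K}`), so `x + e_ν ≠ x`. [cite: Balaban1987RG1, (0.1) p.251 (2L^{m+K} sites), bookkeeping] -/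
theorem shift_ne_self (x : Site (PV d ℓ i.m i.K hd hL) 0) (ν : Fin (PV d ℓ i.m i.K hd hL).d) : x.shift ν ≠ x := by
  intro h
  have h1 : (x.shift ν) ν = x ν := by rw [h]
  simp only [Site.shift, Function.update_self] at h1
  have h2 : (1 : ZMod ((PV d ℓ i.m i.K hd hL).sitesPerDir 0)) = 0 := by
    simpa using congrArg (fun t => t - x ν) h1
  have hlt : 1 < (PV d ℓ i.m i.K hd hL).sitesPerDir 0 := by
    show 1 < 2 * (ℓ + 1) ^ (i.m + i.K - 0)
    have : 1 ≤ (ℓ + 1) ^ (i.m + i.K - 0) := Nat.one_le_pow _ _ (Nat.succ_pos ℓ)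
    omega
  haveI : Fact (1 < (PV d ℓ i.m i.K hd hL).sitesPerDir 0) := ⟨hlt⟩
  exact one_ne_zero h2

/-- ★ **THE FLIPPED PLAQUETTES**: for the plaquettes `p = p_{μ₀ν}(x₀)` (`ν > μ₀`) having `b₀ = ⟨x₀, x₀+e_{μ₀}⟩` as first edge, `U′(∂p) = g·U(∂p)` (any unit `g`) — so a flip
by `g = −1` turns every such plaquette variable into its negative (all of them `−1` when `U = 1`). [cite: Balaban1985BackgroundPropagators, (3.1) p.390 (U(∂p)), (3.35) p.396] -/
theorem holY_update_eq (U : CfgY 𝔸 i) {μ₀ : Fin (PV d ℓ i.m i.K hd hL).d} {x₀ : Site (PV d ℓ i.m i.K hd hL) 0} (g : 𝔸ˣ)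
    (p : PlaqY i) (hsrc : p.src = x₀) (hμ : p.μ = μ₀) :
    holY i (Function.update U μ₀ (Function.update (U μ₀) x₀ (g * U μ₀ x₀))) p = g * holY i U p := by
  subst hsrc; subst hμ
  have hν : ¬ (p.ν = p.μ ∧ p.src.shift p.μ = p.src) := fun h => (ne_of_gt p.hμν) h.1
  have h3 : ¬ (p.μ = p.μ ∧ p.src.shift p.ν = p.src) := fun h => shift_ne_self i p.src p.ν h.2
  have h4 : ¬ (p.ν = p.μ ∧ p.src = p.src) := fun h => (ne_of_gt p.hμν) h.1
  unfold holY
  rw [update_apply_self, update_apply_of_ne i U p.μ p.src g hν, update_apply_of_ne i U p.μ p.src g h3, update_apply_of_ne i U p.μ p.src g h4]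
  simp only [mul_assoc]

omit [NormedAlgebra ℂ 𝔸] [CompleteSpace 𝔸] in
/-- `−1` is central among the units. [folklore] -/
private theorem neg_one_comm (v : 𝔸ˣ) : (-1 : 𝔸ˣ) * v = v * (-1) := by
  rw [neg_one_mul, mul_neg_one]

open scoped Matrix.Norms.L2Operator in
/-- ★★★ **AT THE RECORD'S GAUGE GROUP** (`𝔸 = M_N(ℂ)`, `G = SU(N)`, `N` even so that `−1 ∈ SU(N)`): if no class cube of the member contains both endpoints of
`b₀`, membership in the typed (3.35) class `(bg9K (M_N(ℂ)) (SU(N)) i).Reg335 c α₀` is preserved by `U(b₀) ↦ −U(b₀)`; in particular from `U = 1` (in the class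
for every `c, α₀ > 0`, def-Y's `reg335_one`) one obtains a member of the class whose plaquettes `p_{μ₀ν}(x₀)` all have `U(∂p) = −1` (`holY_update_eq`) — the
typed premise of the N06 binders `Reg335 c35Y α₀ U → …` does not force `|U(∂p) − 1|` small there.  Whether such an uncovered `b₀` exists is a property of the
member's domain sequence (see the module docstring). [cite: Balaban1985BackgroundPropagators, (3.35) p.396, Thm 3.11 p.416] -/
theorem reg335_flipNegOne_of_uncovered {N : ℕ} (hN : Even N) {U : CfgY (Matrix (Fin N) (Fin N) ℂ) i} {c α₀ : ℝ}
    {μ₀ : Fin (PV d ℓ i.m i.K hd hL).d} {x₀ : Site (PV d ℓ i.m i.K hd hL) 0}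
    (hunc : ∀ q ∈ cubeClass396 i, x₀ ∈ q.1 → x₀.shift μ₀ ∉ q.1)
    (h : (bg9K (Matrix (Fin N) (Fin N) ℂ) (B7Prop2SpecialUnitary.specialUnitaryUnits (Fin N)) i).Reg335 c α₀ U) :
    (bg9K (Matrix (Fin N) (Fin N) ℂ) (B7Prop2SpecialUnitary.specialUnitaryUnits (Fin N)) i).Reg335 c α₀
      (Function.update U μ₀ (Function.update (U μ₀) x₀ ((-1) * U μ₀ x₀))) :=
  reg335_update_of_uncovered i (B9Thm311DeltaAFrustratedWitness.neg_one_mem_specialUnitaryUnits hN) neg_one_comm hunc h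

end Consequences

/-! ## §4 Block-interior plaquettes: the (3.69) estimates from the member class WITHOUT a coverage binder -/

section Interior

open scoped Matrix.Norms.L2Operator

variable {d ℓ : ℕ} {hd : 1 ≤ d + 1} {hL : Odd (ℓ + 1) ∧ 1 < ℓ + 1} {b₀ b₁ : ℝ} {N : ℕ}
variable (i : KIdx d ℓ hd hL b₀ b₁)

/-- ★★★ **(3.35) AT A MEMBER ⇒ THE PLAQUETTE ESTIMATE FOR BLOCK-INTERIOR PLAQUETTES, coverage discharged**: if the plaquette's sites `x, x+e_μ, x+e_ν` carry the
same big-`(lev x)`-block label as `x`, then `|U(∂p) − 1| ≤ 2C(1+C)e^{4C}·L^{−2·lev x}`, `C = c·M·α₀`, for every `U` in def-Y's class `(bg9K (M_N(ℂ)) G i).Reg335 c α₀`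
(file 3's `norm_holY_sub_one_le_of_reg335` on §1's block). [cite: Balaban1985BackgroundPropagators, (3.35) p.396, (3.69) p.404] -/
theorem norm_holY_sub_one_le_of_reg335_interior [Nonempty (Fin N)] {G : Subgroup (Matrix (Fin N) (Fin N) ℂ)ˣ} (U : CfgY (Matrix (Fin N) (Fin N) ℂ) i)
    {c α₀ : ℝ} (hC : 0 ≤ c * (kGeo i).M * α₀) (h : (bg9K (Matrix (Fin N) (Fin N) ℂ) G i).Reg335 c α₀ U) (p : PlaqY i)
    (hμ : B4Reflection242.blk (B6MultiLevelBoxOperator.bigSide ℓ i.Mh (levV1 i p.src)) (toBox i.hN (p.src.shift p.μ)).1 = B4Reflection242.blk (B6MultiLevelBoxOperator.bigSide ℓ i.Mh (levV1 i p.src)) (toBox i.hN p.src).1)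
    (hν : B4Reflection242.blk (B6MultiLevelBoxOperator.bigSide ℓ i.Mh (levV1 i p.src)) (toBox i.hN (p.src.shift p.ν)).1 = B4Reflection242.blk (B6MultiLevelBoxOperator.bigSide ℓ i.Mh (levV1 i p.src)) (toBox i.hN p.src).1) :
    ‖((holY i U p : (Matrix (Fin N) (Fin N) ℂ)ˣ) : Matrix (Fin N) (Fin N) ℂ) - 1‖ ≤
      2 * (c * (kGeo i).M * α₀) * (1 + c * (kGeo i).M * α₀) * Real.exp (4 * (c * (kGeo i).M * α₀)) * (((kGeo i).L ^ levV1 i p.src)⁻¹) ^ 2 := by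
  obtain ⟨q, hq, hq2, hblk⟩ := exists_cubeClass396_block i p.src
  have key := norm_holY_sub_one_le_of_reg335 i U hC h hq p (hblk _ rfl) (hblk _ hμ) (hblk _ hν)
  rwa [hq2] at key

end Interior

end Literature.MathematicalPhysics.QuantumFieldTheory.Balaban1983to89.B9Eq335CoverageAtLettersY
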